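import Summits.BirchSwinnertonDyer.Rank1Residual.Additive.ChiEigenPrimeToPDescent
import HarnessLib

/-!
# The `Λ`-dual datum of the `F`-level eigenspace `Sel_{p^∞}(E♭/F·K·ℚ_∞)^{(χ_K)}` and the transport of
# dual data along the eigen-descent (cell `b2b-bsdres`, sub-cell additive-p2, gen 12; sequel 1 of
# `ChiEigenPrimeToPDescent.lean`)

HONEST FRAMING (cell `b2b-bsdres`, run/shared/lean/b2b/bsd-rank1-residual/, verbatim in every
file): the goal of the cell is to DELETE the COMBINATION-SHAPED residual classes of the
Birch–Swinnerton-Dyer formula for ALL analytic-rank `≤ 1` elliptic curves over `ℚ` — "full BSD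
formula for every rank `≤ 1` curve in class `C`" assembled STRICTLY from published theorems — so
that the rank-`≤ 1` remainder becomes exactly the CONSTRUCTION-SHAPED classes, which are TYPED
(missing-input `Prop`s), NOT attempted. This is not "finishing BSD". Sub-cell `additive-p2`
(CLASS-OWNERS row "X3/X4 additive — pot. good ordinary / X3♯(G-ord)"), generation 12: research
route; no claim beyond the stated classes; X3♯(G-ord)/X4♯(G-ord) stay CONSTRUCTION-SHAPED; labels /
census / located gap UNCHANGED; nothing is booked. One hypothesis STRUCTURE (field for field
additive-p1's `ChiEigenSelmerDualData` with `chiEigenSelmerIn` in place of `chiEigenSelmer`; no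
predicate, no named fact), definitions = concrete maps, and theorems.

Context: `ChiEigenPrimeToPDescent.lean` (this generation) proves the eigen-descent
`chiEigenRestrictionEquiv : Sel_{p^∞}(E♭/K·ℚ_∞)^{(χ_K)} ≃+ Sel_{p^∞}(E♭/F·K·ℚ_∞)^{(χ_K)}`
(`F = ℚ̄^U`, `U` open normal, `p ∤ [Γ_ℚ : U]`), equivariant for every `γ ∈ Γ_ℚ`. This file:

* `ChiEigenSelmerInDualData V K κ U γ` — an abstract `Λ = ℤ_p⟦T⟧`-module `X` with
  `X ≅ Hom(chiEigenSelmerIn, ℚ/ℤ)`, `T ↔ γ_* − 1`, constants through `ℤ_p → ℤ/p^k`; for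
  `U = galRange F`, `F = ℚ(ζ_p) ⊃ K = ℚ(√p*)`, `γ ∈ Gal(ℚ̄/F)`: the `Λ(Γ)`-module
  `e_{(p−1)/2}·X(E♭/ℚ(μ_{p^∞}))` of Kato 2004 §17.3 / Wuthrich 2014 §3 — THE VOCABULARY of the
  componentwise reading-fact (brick 4′ of HOME/b2b-bsdres-additive-p1/KERNEL-C-P3.md §3) at every
  odd `p`; `congrGen` re-labels a datum along an equality of actions on the eigenspace;
* `ChiEigenSelmerDualData.toIn` — additive-p1's `K`-level eigen datum IS an `F`-level eigen datum
  with the SAME module (`toIn_X`, `charIdeal_toIn`, `isTorsion_toIn_iff` literal);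
* `SelmerDualData.toChiEigenIn` — with additive-p1's `SelmerDualData.toChiEigen` ([C], `TwistDescent` /
  `ChiEigenSelmerDual`): EVERY `Λ`-dual datum `D` of `Sel_{p^∞}(E/ℚ_∞)` (`E = E♭ ⊗ χ_K`, any model,
  `p` odd, `γ ∈ Gal(ℚ̄/K)`) is an `F`-level eigen datum with module `D.X`, so
  `charIdeal`/`IsTorsion` agree literally (`charIdeal_toChiEigenIn`, `isTorsion_toChiEigenIn_iff`).

Sequel: `ChiEigenPrimeToPDescentGenerator.lean` (generator normalisation into `Gal(ℚ̄/K) ⊓ U`,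
`U = galRange ℚ(ζ_p)`, end-to-end packaging). Nothing here is specific to X3/X4; labels UNCHANGED.

References: R. Greenberg, LNM 1716 (1999), §1 p. 60 (`X = Hom(Sel, ℚ_p/ℤ_p)` as a `Λ`-module) and
§5 p. 143 [GreenbergLNM1716]; C. Wuthrich, Doc. Math. 19 (2014) §3 p. 390 [Wuthrich2014]; K. Kato,
Astérisque 295 (2004) §17.3 [Kato2004Asterisque].
-/

noncomputable section

open scoped Classical

namespace Summit.BirchSwinnertonDyer.Rank1Residual.Additive

open Literature.NumberTheory.EllipticCurves Literature.NumberTheory.GaloisRepresentations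
  WeierstrassCurve Summit.BirchSwinnertonDyer.Rank1Residual.AdditivePotMult

/-! ## §3 The `Λ`-dual datum of the `F`-level eigenspace and the transport from additive-p1's datum -/

section Dual

variable (V : WeierstrassCurve ℚ) (K : Type) [Field K] [NumberField K] {p : ℕ} [Fact p.Prime]
  (κ : ZpExtension ℚ p) [(galRange (K := ℚ) K).Normal]
  (U : Subgroup (Field.absoluteGaloisGroup ℚ)) [U.Normal] (γ : Field.absoluteGaloisGroup ℚ)

/-- **The `Λ`-dual datum of `Sel_{p^∞}(E♭/F·K·ℚ_∞)^{(χ_K)}`** (`F = ℚ̄^U`): an abstract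
`Λ = ℤ_p⟦T⟧`-module `X` with a group isomorphism onto `Hom(chiEigenSelmerIn, ℚ/ℤ)` under which `T`
acts as `γ_* − 1` and constants through `ℤ_p → ℤ/p^k` — field for field additive-p1's
`ChiEigenSelmerDualData` with `chiEigenSelmerIn` in place of `chiEigenSelmer`. For `U = galRange F`,
`F = ℚ(ζ_p)`, `K = ℚ(√p*)`, `γ ∈ Gal(ℚ̄/F)` a topological generator: the `Λ(Γ)`-module
`e_{(p−1)/2}·X(E♭/ℚ(μ_{p^∞}))` of Kato 2004 §17.3 / Wuthrich 2014 §3 — the vocabulary of the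
componentwise reading-fact (brick 4′) at every odd `p`. [cite: GreenbergLNM1716, §1 p. 60] -/
structure ChiEigenSelmerInDualData where
  /-- The underlying type of the Iwasawa module `X^{(χ)}`. -/
  X : Type
  /-- `X` is an abelian group. -/
  [addCommGroup : AddCommGroup X]
  /-- `X` is a `Λ = ℤ_p⟦T⟧`-module. -/
  [module : Module (IwasawaAlgebra p) X]
  /-- The identification of `X` with the character group `Hom(Sel^{(χ)}, ℚ/ℤ)`. -/
  toDual : X →+ (chiEigenSelmerIn V K p κ U →+ AddCircle (1 : ℚ))
  /-- `toDual` is a group isomorphism. -/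
  bijective : Function.Bijective toDual
  /-- `T` acts as `γ - 1`. -/
  toDual_T_smul : ∀ (x : X) (s : chiEigenSelmerIn V K p κ U),
    toDual ((PowerSeries.X : IwasawaAlgebra p) • x) s =
      toDual x ⟨V.conjH1 p _ γ s, conjH1_mem_chiEigenSelmerIn γ s.2⟩ - toDual x s
  /-- Constants `c ∈ ℤ_p` act on `p^k`-torsion classes through `ℤ_p → ℤ/p^k`. -/
  toDual_C_smul : ∀ (c : ℤ_[p]) (x : X) (s : chiEigenSelmerIn V K p κ U) (k : ℕ), (p ^ k) • s = 0 →
    toDual (PowerSeries.C c • x) s = (PadicInt.toZModPow k c).val • toDual x s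

attribute [instance] ChiEigenSelmerInDualData.addCommGroup ChiEigenSelmerInDualData.module

variable {V K κ U γ}

/-- **Re-labelling along an equality of actions ON THE EIGENSPACE**: if `γ'_* = γ_*` on
`chiEigenSelmerIn` then a datum at `γ` is a datum at `γ'` with the SAME module, map and identities
(the `F`-level twin of additive-p1's `SelmerDualData.congrGen`, which asks equality on all of `H¹`).
[folklore] -/
def ChiEigenSelmerInDualData.congrGen {γ' : Field.absoluteGaloisGroup ℚ}
    (h : ∀ t : chiEigenSelmerIn V K p κ U,
      V.conjH1 p _ γ' (t : V.subgroupH1 p (κ.kerSubgroup ⊓ galRange (K := ℚ) K ⊓ U)) =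
        V.conjH1 p _ γ (t : V.subgroupH1 p (κ.kerSubgroup ⊓ galRange (K := ℚ) K ⊓ U)))
    (D : ChiEigenSelmerInDualData V K κ U γ) : ChiEigenSelmerInDualData V K κ U γ' where
  X := D.X
  toDual := D.toDual
  bijective := D.bijective
  toDual_T_smul := fun x s ↦ by
    rw [D.toDual_T_smul]
    congr 2
    exact Subtype.ext (h s).symm
  toDual_C_smul := D.toDual_C_smul

/-- The re-labelled datum has the same module. [folklore] -/
theorem ChiEigenSelmerInDualData.congrGen_X {γ' : Field.absoluteGaloisGroup ℚ}
    (h : ∀ t : chiEigenSelmerIn V K p κ U,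
      V.conjH1 p _ γ' (t : V.subgroupH1 p (κ.kerSubgroup ⊓ galRange (K := ℚ) K ⊓ U)) =
        V.conjH1 p _ γ (t : V.subgroupH1 p (κ.kerSubgroup ⊓ galRange (K := ℚ) K ⊓ U)))
    (D : ChiEigenSelmerInDualData V K κ U γ) :
    (ChiEigenSelmerInDualData.congrGen h D).X = D.X :=
  rfl

/-- Same characteristic ideal after re-labelling. [folklore] -/
theorem ChiEigenSelmerInDualData.charIdeal_congrGen {γ' : Field.absoluteGaloisGroup ℚ}
    (h : ∀ t : chiEigenSelmerIn V K p κ U,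
      V.conjH1 p _ γ' (t : V.subgroupH1 p (κ.kerSubgroup ⊓ galRange (K := ℚ) K ⊓ U)) =
        V.conjH1 p _ γ (t : V.subgroupH1 p (κ.kerSubgroup ⊓ galRange (K := ℚ) K ⊓ U)))
    (D : ChiEigenSelmerInDualData V K κ U γ) :
    Literature.NumberTheory.EllipticCurves.Module.charIdeal (IwasawaAlgebra p)
        (ChiEigenSelmerInDualData.congrGen h D).X =
      Literature.NumberTheory.EllipticCurves.Module.charIdeal (IwasawaAlgebra p) D.X :=
  rfl

/-- Same torsion-ness after re-labelling. [folklore] -/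
theorem ChiEigenSelmerInDualData.isTorsion_congrGen_iff {γ' : Field.absoluteGaloisGroup ℚ}
    (h : ∀ t : chiEigenSelmerIn V K p κ U,
      V.conjH1 p _ γ' (t : V.subgroupH1 p (κ.kerSubgroup ⊓ galRange (K := ℚ) K ⊓ U)) =
        V.conjH1 p _ γ (t : V.subgroupH1 p (κ.kerSubgroup ⊓ galRange (K := ℚ) K ⊓ U)))
    (D : ChiEigenSelmerInDualData V K κ U γ) :
    Module.IsTorsion (IwasawaAlgebra p) (ChiEigenSelmerInDualData.congrGen h D).X ↔
      Module.IsTorsion (IwasawaAlgebra p) D.X :=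
  Iff.rfl

variable (V K κ U γ) [V.IsElliptic] (hU : IsOpen (U : Set (Field.absoluteGaloisGroup ℚ)))
  (hcop : U.index.Coprime p)

/-- Precomposition with the inverse eigen-descent, on character groups. [folklore] -/
def dualDescend :
    (chiEigenSelmer V K p κ →+ AddCircle (1 : ℚ)) →+ (chiEigenSelmerIn V K p κ U →+ AddCircle (1 : ℚ)) :=
  AddMonoidHom.compHom' (chiEigenRestrictionEquiv V K p κ U hU hcop).symm.toAddMonoidHom

/-- Values of `dualDescend`. [folklore] -/
theorem dualDescend_apply (x : chiEigenSelmer V K p κ →+ AddCircle (1 : ℚ))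
    (t : chiEigenSelmerIn V K p κ U) :
    dualDescend V K κ U hU hcop x t = x ((chiEigenRestrictionEquiv V K p κ U hU hcop).symm t) :=
  rfl

/-- `dualDescend` is bijective (precomposition with an isomorphism). [folklore] -/
theorem dualDescend_bijective : Function.Bijective (dualDescend V K κ U hU hcop) := by
  set e := chiEigenRestrictionEquiv V K p κ U hU hcop
  refine ⟨fun x y hxy ↦ ?_, fun z ↦ ⟨z.comp e.toAddMonoidHom, ?_⟩⟩
  · ext s
    have h := DFunLike.congr_fun hxy (e s)
    rw [dualDescend_apply, dualDescend_apply, AddEquiv.symm_apply_apply] at h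
    exact h
  · ext t
    rw [dualDescend_apply, AddMonoidHom.comp_apply]
    change z (e (e.symm t)) = z t
    rw [AddEquiv.apply_symm_apply]

/-- **Transport of additive-p1's `K`-level eigen datum to the `F`-level (brick 3′, consumer
direction).** A `Λ`-dual datum of `Sel_{p^∞}(E♭/K·ℚ_∞)^{(χ_K)}` at `γ` IS a `Λ`-dual datum of
`Sel_{p^∞}(E♭/F·K·ℚ_∞)^{(χ_K)}` at the same `γ` with the SAME underlying `Λ`-module, through the
eigen-descent (equivariant for every `γ ∈ Γ_ℚ`). Hence `charIdeal` and `IsTorsion` coincide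
literally (`charIdeal_toIn`, `isTorsion_toIn_iff`). [cite: GreenbergLNM1716, §5 p. 143] -/
def ChiEigenSelmerDualData.toIn (D : ChiEigenSelmerDualData V K κ γ) :
    ChiEigenSelmerInDualData V K κ U γ where
  X := D.X
  toDual := (dualDescend V K κ U hU hcop).comp D.toDual
  bijective := (dualDescend_bijective V K κ U hU hcop).comp D.bijective
  toDual_T_smul := fun x t ↦ by
    rw [AddMonoidHom.comp_apply, AddMonoidHom.comp_apply, dualDescend_apply, dualDescend_apply,
      dualDescend_apply, D.toDual_T_smul]
    congr 2
    apply Subtype.ext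
    exact (coe_chiEigenRestrictionEquiv_symm_conjH1 V K p κ U hU hcop γ t).symm
  toDual_C_smul := fun c x t k hk ↦ by
    rw [AddMonoidHom.comp_apply, AddMonoidHom.comp_apply, dualDescend_apply, dualDescend_apply]
    exact D.toDual_C_smul c x _ k (by rw [← map_nsmul, hk, map_zero])

/-- The transported datum has the same underlying module. [folklore] -/
theorem ChiEigenSelmerDualData.toIn_X (D : ChiEigenSelmerDualData V K κ γ) :
    (ChiEigenSelmerDualData.toIn V K κ U γ hU hcop D).X = D.X :=
  rfl

/-- **Same characteristic ideal.** [folklore] -/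
theorem ChiEigenSelmerDualData.charIdeal_toIn (D : ChiEigenSelmerDualData V K κ γ) :
    Literature.NumberTheory.EllipticCurves.Module.charIdeal (IwasawaAlgebra p)
        (ChiEigenSelmerDualData.toIn V K κ U γ hU hcop D).X =
      Literature.NumberTheory.EllipticCurves.Module.charIdeal (IwasawaAlgebra p) D.X :=
  rfl

/-- **Same torsion-ness.** [folklore] -/
theorem ChiEigenSelmerDualData.isTorsion_toIn_iff (D : ChiEigenSelmerDualData V K κ γ) :
    Module.IsTorsion (IwasawaAlgebra p) (ChiEigenSelmerDualData.toIn V K κ U γ hU hcop D).X ↔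
      Module.IsTorsion (IwasawaAlgebra p) D.X :=
  Iff.rfl

end Dual

/-! ## §4 From a `Λ`-dual datum of `Sel_{p^∞}(E/ℚ_∞)` to the `F`-level eigen datum (same module) -/

section FromRat

variable (V : WeierstrassCurve ℚ) (K : Type) [Field K] [NumberField K]
  (h2 : Module.finrank ℚ K = 2) {θ : K} {c : ℚ} (hθ : θ ∉ Set.range (algebraMap ℚ K))
  (hc : θ ^ 2 = algebraMap ℚ K c) (p : ℕ) [Fact p.Prime] (κ : ZpExtension ℚ p)
  [(galRange (K := ℚ) K).Normal] [(V.quadraticTwist c).IsElliptic] [V.IsElliptic]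
  {W : WeierstrassCurve ℚ} {C : VariableChange ℚ} (hCW : C • V.quadraticTwist c = W)
  (U : Subgroup (Field.absoluteGaloisGroup ℚ)) [U.Normal]
  (hU : IsOpen (U : Set (Field.absoluteGaloisGroup ℚ))) (hcop : U.index.Coprime p)
  (hp2 : p ≠ 2) {γ : Field.absoluteGaloisGroup ℚ} (hγ : γ ∈ galRange (K := ℚ) K)

include hγ in
/-- **[C] followed by the eigen-descent, on dual data.** For `E = E♭ ⊗ χ_K` (`C • V^{(c)} = W`,
`K = ℚ(θ)`, `θ² = c`), `p` odd, `γ ∈ Gal(ℚ̄/K)`, `U` open normal with `p ∤ [Γ_ℚ : U]`: every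
`Λ`-dual datum `D` of `Sel_{p^∞}(E/ℚ_∞)` is a `Λ`-dual datum of `Sel_{p^∞}(E♭/F·K·ℚ_∞)^{(χ_K)}`
(`F = ℚ̄^U`) with the SAME module `D.X` — additive-p1's `SelmerDualData.toChiEigen` then `toIn`.
[cite: GreenbergLNM1716, §5 p. 143] -/
def SelmerDualData.toChiEigenIn (D : W.SelmerDualData κ γ) : ChiEigenSelmerInDualData V K κ U γ :=
  ChiEigenSelmerDualData.toIn V K κ U γ hU hcop
    (SelmerDualData.toChiEigen V K h2 hθ hc p κ hCW hγ hp2 D)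

/-- Same module. [folklore] -/
theorem SelmerDualData.toChiEigenIn_X (D : W.SelmerDualData κ γ) :
    (SelmerDualData.toChiEigenIn V K h2 hθ hc p κ hCW U hU hcop hp2 hγ D).X = D.X :=
  rfl

/-- **Same characteristic ideal**: a divisibility in `char_Λ` of the `F`-level eigen datum is a
divisibility in `D.charIdeal = char_Λ X(E/ℚ_∞)`. [folklore] -/
theorem SelmerDualData.charIdeal_toChiEigenIn (D : W.SelmerDualData κ γ) :
    Literature.NumberTheory.EllipticCurves.Module.charIdeal (IwasawaAlgebra p)
        (SelmerDualData.toChiEigenIn V K h2 hθ hc p κ hCW U hU hcop hp2 hγ D).X = D.charIdeal :=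
  rfl

/-- **Same torsion-ness.** [folklore] -/
theorem SelmerDualData.isTorsion_toChiEigenIn_iff (D : W.SelmerDualData κ γ) :
    Module.IsTorsion (IwasawaAlgebra p)
        (SelmerDualData.toChiEigenIn V K h2 hθ hc p κ hCW U hU hcop hp2 hγ D).X ↔ D.IsTorsion :=
  Iff.rfl

end FromRat

end Summit.BirchSwinnertonDyer.Rank1Residual.Additive

end
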